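import Summits.Ventures.HodgeRepro2.T5SU11KernelUniformBoundsLam
import Summits.Ventures.HodgeRepro2.T5SU11KernelCompositionContinuousLam

/-!
# Summary XXVII — uniformity in the spectral parameter down to the edge, and joint continuity in `(λ, t, s)` (rows 615–617),
under uniform names

Throughout `μ = λ(λ − 2)`, `K_λ` the kernel of `G^I_λ`, `K_1` the edge kernel, `K_λ^{∘(n+1)}(t, s) = (G^I_λ)ⁿ K_λ(·, s)(t)` the composed
kernels, `Ξ = φ_1` the ground state, `{max(t, s) ≥ a}` the region away from the corner.

* `edge_sphDecay_le_exp`, `edge_kernel_two_sided`, `kernel_abs_le_edge`, `kernel_two_sided_uniform_lam`, `kernel_source_uniform_lam` —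
  **`|K_1(t, s)| ≤ C Ξ(t) Ξ(s)` on `{max(t, s) ≥ a}`, `|K_λ| ≤ |K_1|`, hence ONE constant for all `λ > 1`** (row 615);
* `kernel_comp_uniform_lam`, `kernel_lipschitz_uniform_lam`, `kernel_neumann_remainder_uniform_lam` — **the composed kernels, the
  Lipschitz bound and the Neumann remainder with constants independent of the spectral parameters** (row 616);
* `kernel_comp_continuous_lam`, `kernel_continuous_lam` — **`(λ, t, s) ↦ K_λ^{∘(n+1)}(t, s)` is continuous on `(1, ∞) × (0, ∞)²`** (row 617).

Nothing is claimed about (N).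

Blind lane: Mathlib + the HodgeRepro2 prefix only; no sorry; axioms ⊆ {propext, Classical.choice,
Quot.sound}.
-/

namespace Summit.Ventures.HodgeRepro2.T5SU11RadialSummaryXXVII

open Filter Topology MeasureTheory
open Set (Ioi Ioc)
open T5SU11Cartan T5SU11SphericalFunction T5SU11SphericalDecay T5SU11RadialGreenKernel T5SU11RadialGreenImproper
  T5SU11KernelTwoSidedBoundEdge T5SU11KernelUniformBoundsLam T5SU11KernelCompositionContinuousLam

section measure

variable [MeasurableSpace Circle] [BorelSpace Circle]

/-- **`χ_1(s) ≤ c e^{−s}` on `[a, ∞)`** (row 615). -/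
theorem edge_sphDecay_le_exp {a : ℝ} (ha : 0 < a) :
    ∃ c : ℝ, 0 < c ∧ ∀ s, a ≤ s → sphDecay 1 s ≤ c * Real.exp (-s) :=
  exists_sphDecay_one_le_exp_of_le ha

/-- **The two-sided ground-state bound of the edge kernel** on `{max(t, s) ≥ a}` (row 615). -/
theorem edge_kernel_two_sided {a : ℝ} (ha : 0 < a) :
    ∃ C : ℝ, 0 < C ∧ ∀ t s, 0 < t → 0 < s → a ≤ max t s →
      |sphGreenKernel 1 t s| ≤ C * (sph 1 (hyp t) * sph 1 (hyp s)) :=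
  exists_abs_kernel_one_le_mul_sph_one ha

/-- **`|K_λ(t, s)| ≤ |K_1(t, s)|`**: the edge kernel dominates every Green's kernel (row 615). -/
theorem kernel_abs_le_edge {lam : ℝ} (hlam : 1 < lam) {t s : ℝ} (ht : 0 < t) (hs : 0 < s) :
    |sphGreenKernel lam t s| ≤ |sphGreenKernel 1 t s| :=
  abs_kernel_le_abs_kernel_one hlam ht hs

/-- **One constant for all `λ > 1`**: `|K_λ(t, s)| ≤ C Ξ(t) Ξ(s)` on `{max(t, s) ≥ a}` (row 615). -/
theorem kernel_two_sided_uniform_lam {a : ℝ} (ha : 0 < a) :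
    ∃ C : ℝ, 0 < C ∧ ∀ lam, 1 < lam → ∀ t s, 0 < t → 0 < s → a ≤ max t s →
      |sphGreenKernel lam t s| ≤ C * (sph 1 (hyp t) * sph 1 (hyp s)) :=
  exists_abs_kernel_le_mul_sph_one_uniform_lam ha

/-- **The kernel sources in `W_1` with a constant `C Ξ(s)` independent of `λ`** (row 615). -/
theorem kernel_source_uniform_lam {a : ℝ} (ha : 0 < a) :
    ∃ C : ℝ, 0 < C ∧ ∀ lam, 1 < lam → ∀ s, a ≤ s → ∀ r, 0 < r →
      |sphGreenKernel lam r s| ≤ (C * sph 1 (hyp s)) * sph 1 (hyp r) :=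
  exists_kernel_source_le_mul_sph_one_uniform_lam ha

/-- **The composed kernels with a constant independent of `λ`** (row 616). -/
theorem kernel_comp_uniform_lam {a : ℝ} (ha : 0 < a) :
    ∃ C : ℝ, 0 < C ∧ ∀ lam, 1 < lam → ∀ n : ℕ, ∀ t s, 0 < t → a ≤ s →
      |((greenSolI (fun t => sph lam (hyp t)) (sphDecay lam))^[n] (fun r => sphGreenKernel lam r s)) t|
        ≤ C * sph 1 (hyp s) * sph 1 (hyp t) / ((lam - 1) ^ 2) ^ n :=
  exists_kernel_comp_le_uniform_lam ha

/-- **The Lipschitz bound in `μ` with a constant independent of both spectral parameters** (row 616). -/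
theorem kernel_lipschitz_uniform_lam {a : ℝ} (ha : 0 < a) :
    ∃ C : ℝ, 0 < C ∧ ∀ lam lam₂, 1 < lam → 1 < lam₂ → ∀ t s, 0 < t → a ≤ s →
      |sphGreenKernel lam t s - sphGreenKernel lam₂ t s|
        ≤ |lam * (lam - 2) - lam₂ * (lam₂ - 2)| * (C * sph 1 (hyp s) * sph 1 (hyp t) / (lam - 1) ^ 2) :=
  exists_abs_kernel_sub_le_uniform_lam ha

/-- **The kernel's Neumann remainder with a constant independent of both spectral parameters** (row 616). -/
theorem kernel_neumann_remainder_uniform_lam {a : ℝ} (ha : 0 < a) :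
    ∃ C : ℝ, 0 < C ∧ ∀ lam lam₂, 1 < lam → 1 < lam₂ → ∀ t s, 0 < t → a ≤ s → ∀ n : ℕ,
      |sphGreenKernel lam t s - ∑ k ∈ Finset.range (n + 2), (lam * (lam - 2) - lam₂ * (lam₂ - 2)) ^ k
          * ((greenSolI (fun t => sph lam₂ (hyp t)) (sphDecay lam₂))^[k] (fun r => sphGreenKernel lam₂ r s)) t|
        ≤ |lam * (lam - 2) - lam₂ * (lam₂ - 2)| * (C * sph 1 (hyp s) * sph 1 (hyp t) / (lam - 1) ^ 2
          * (|lam * (lam - 2) - lam₂ * (lam₂ - 2)| / (lam₂ - 1) ^ 2) ^ (n + 1)) :=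
  exists_kernel_neumann_remainder_le_uniform_lam ha

/-- **The composed kernels are jointly continuous in `(λ, t, s)`** on `(1, ∞) × (0, ∞)²` (row 617). -/
theorem kernel_comp_continuous_lam (n : ℕ) :
    ContinuousOn (fun p : ℝ × ℝ × ℝ => ((greenSolI (fun t => sph p.1 (hyp t)) (sphDecay p.1))^[n]
      (fun r => sphGreenKernel p.1 r p.2.2)) p.2.1) (Ioi 1 ×ˢ Ioi 0 ×ˢ Ioi 0) :=
  continuousOn_kernel_comp_prod3 n

/-- **The kernel is jointly continuous in `(λ, t, s)`** on `(1, ∞) × (0, ∞)²` (row 617). -/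
theorem kernel_continuous_lam :
    ContinuousOn (fun p : ℝ × ℝ × ℝ => sphGreenKernel p.1 p.2.1 p.2.2) (Ioi 1 ×ˢ Ioi 0 ×ˢ Ioi 0) :=
  continuousOn_kernel_prod3

end measure

end Summit.Ventures.HodgeRepro2.T5SU11RadialSummaryXXVII
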